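import Summits.Ventures.HSemireg.Pad4TowerCrossPhase

/-!
# Strengthen MEMO-04 companion — the level-L1 arrow rule of LABEL-SAT(ν, X̂[1−i]) as a typed Boolean vocabulary

MEMO-04 §1.4 ∕ §4 (`STRENGTHEN-MEMO-04-DESCENT-LEVELS.md`): a TORSION-LABELLED letter object on a design's own cells carries, per
term, a label `χ ∈ X̂[1−i] ≅ ((ℤ∕2)²)⁴` — one element of `(ℤ∕2)²` per pair-factor. An arrow `k → j` over the balanced difference
`Δ = Z_j − Z_k` (componentwise `bsub`) is ALIVE iff in EVERY factor `f`: `Δ_f` is non-degenerate (any labels — twist = translate), or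
`Δ_f = 0` with EQUAL labels, or `Δ_f` is null non-zero with label jump in `{0, χ_d}`, where `χ_d = (1,1)` is the direction-independent
null-torus character ([PEN] in MEMO-04 §4, ×2 asked as ASK-5). Labels never raise a capacity: a live arrow has the CANONICAL
capacity (`Π_f kFactor Δ_f`, c4-1), a dead one has `0`; label jumps move base loci (`𝒪(F) ⊗ P_{χ_d} ≅ 𝒪(F′)`).

This file types exactly that rule as computable `Bool`-valued functions (no instances, no notation), proves that CANONICAL labels
(all `0`) kill no effective arrow — so level L0 ⊂ L1 — and records three `decide` examples. HONEST FRAMING: finite bookkeeping on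
the letter model; no sheaf, no Pic⁰, no monad, no SOURCE, no SEED is constructed; LABEL-SAT itself (the existence question over
labellings with Hall ∕ kill ∕ display constraints) is NOT typed here — only its arrow rule; nothing toward 18881∕H2, HC_AV, HC_CM
or HC. No proof placeholders, no new axioms.
-/

namespace Summit.HodgeConjecture.HodgeConjecture.Cruxes.BlochSeedDiscOne.StrengthenLabels

open Summit.Ventures.HSemireg.Pad4Tower

/-- a per-factor label: an element of `(ℤ∕2)²` = the (1−i)-torsion characters of one pair-factor `Ŝ`, `S = E₀²`. -/
abbrev FLabel := ZMod 2 × ZMod 2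

/-- a term label: one `FLabel` per pair-factor (`X̂[1−i] ≅ ((ℤ∕2)²)⁴`, 256 labels). -/
abbrev TLabel := Fin 4 → FLabel

/-- the null-torus character `χ_d = (P₀, P₀)`: the unique non-trivial (1−i)-character lying on `B_F` for EVERY null direction of the
block slice (MEMO-04 §4 [PEN]). -/
def chiD : FLabel := (1, 1)

/-- `Δ` is the zero difference. -/
def isZeroB (Δ : BPoint) : Bool := decide (Δ = (0, 0, 0))

/-- `Δ` is null (isotropic): `Δx² + Δy² = Δα²`. -/
def isNullB (Δ : BPoint) : Bool := decide (Δ.2.1 ^ 2 + Δ.2.2 ^ 2 = Δ.1 ^ 2)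

/-- per-factor arrow rule of level L1 (MEMO-04 §1.4): alive iff non-degenerate, or zero with equal labels, or null non-zero with
label jump in `{0, χ_d}`. (Effectivity of `Δ` is the design's business and is not re-tested here.) -/
def factorAliveB (Δ : BPoint) (lj lk : FLabel) : Bool :=
  if isZeroB Δ then decide (lj = lk)
  else if isNullB Δ then decide (lj - lk = 0 ∨ lj - lk = chiD)
  else true

/-- arrow rule for a pair of cells `P ≤ Z` with term labels `lP`, `lZ`: alive iff alive in every factor. -/
def arrowAliveB (P Z : MCell) (lP lZ : TLabel) : Bool :=
  decide (∀ f : Fin 4, factorAliveB (bsub (Z f) (P f)) (lZ f) (lP f) = true)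

/-- the canonical labelling (level L0): every term labelled `0`. -/
def canonicalLabel : TLabel := fun _ => (0, 0)

/-! ## L0 ⊂ L1: canonical labels kill no arrow -/

theorem factorAliveB_canonical (Δ : BPoint) (l : FLabel) : factorAliveB Δ l l = true := by
  unfold factorAliveB
  by_cases h0 : isZeroB Δ = true
  · simp [h0]
  · by_cases hn : isNullB Δ = true
    · simp [h0, hn]
    · simp [h0, hn]

theorem arrowAliveB_canonical (P Z : MCell) : arrowAliveB P Z canonicalLabel canonicalLabel = true := by
  unfold arrowAliveB
  simp [factorAliveB_canonical]

/-- equal labels on both terms (any common label) also kill nothing: a GLOBAL label shift is invisible (MEMO-04 §1.3: labels are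
defined up to a global shift). -/
theorem arrowAliveB_const (P Z : MCell) (l : TLabel) : arrowAliveB P Z l l = true := by
  unfold arrowAliveB
  simp [factorAliveB_canonical]


/-! ## Effective palette `{0, χ_d}` (bus l.6211 (2)): over a degenerate difference (zero or null) a live arrow's label jump lies in
`{0, χ_d}` — the «coordinate» jumps `(1,0)`, `(0,1)` kill every such arrow, so per factor only `{0, χ_d} ≅ ℤ∕2` is ever useful and
the effective term palette is `{0, χ_d}⁴ ≅ (ℤ∕2)⁴` (16 labels). -/

theorem jump_of_alive_degenerate (Δ : BPoint) (lj lk : FLabel)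
    (hdeg : isZeroB Δ = true ∨ isNullB Δ = true) (halive : factorAliveB Δ lj lk = true) :
    lj - lk = 0 ∨ lj - lk = chiD := by
  unfold factorAliveB at halive
  by_cases h0 : isZeroB Δ = true
  · simp only [h0, ↓reduceIte, decide_eq_true_eq] at halive
    left; rw [halive, sub_self]
  · have hn : isNullB Δ = true := hdeg.resolve_left h0
    simp only [h0, hn, ↓reduceIte, decide_eq_true_eq, Bool.false_eq_true] at halive
    exact halive

/-- the coordinate jump `(1,0)` kills every arrow over a degenerate difference. -/
theorem coordJump_kills (Δ : BPoint) (lk : FLabel) (hdeg : isZeroB Δ = true ∨ isNullB Δ = true) :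
    factorAliveB Δ (lk + (1, 0)) lk = false := by
  by_contra h
  rw [Bool.not_eq_false] at h
  have := jump_of_alive_degenerate Δ (lk + (1, 0)) lk hdeg h
  rw [add_sub_cancel_left] at this
  rcases this with h1 | h1
  · exact absurd (congrArg Prod.fst h1) (by decide)
  · exact absurd (congrArg Prod.snd h1) (by unfold chiD; decide)

/-- over a NON-degenerate difference every jump is alive (twist = translate). -/
theorem alive_of_nondegenerate (Δ : BPoint) (lj lk : FLabel) (h0 : isZeroB Δ = false) (hn : isNullB Δ = false) :
    factorAliveB Δ lj lk = true := by
  unfold factorAliveB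
  simp [h0, hn]

/-! ## Three `decide` examples (one pair-factor each): the unit null step `(1,1,0)` survives the jump `χ_d` and dies under the jump
`(1,0)`; the zero difference dies under any non-zero jump; a timelike difference `(2,0,0)` survives every jump. -/

example : factorAliveB (1, 1, 0) chiD (0, 0) = true := by decide
example : factorAliveB (1, 1, 0) (1, 0) (0, 0) = false := by decide
example : factorAliveB (0, 0, 0) chiD (0, 0) = false := by decide
example : factorAliveB (2, 0, 0) (1, 0) (0, 0) = true := by decide
example : factorAliveB (2, 0, 0) (0, 1) chiD = true := by decide

end Summit.HodgeConjecture.HodgeConjecture.Cruxes.BlochSeedDiscOne.StrengthenLabels
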